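import Literature.AlgebraicGeometry.Milne1999.TateFromCodesHC
import Literature.AlgebraicGeometry.Milne1999.CMHodgeHypothesisIffCodesHC
import Literature.AlgebraicGeometry.ComplexMultiplication.CMTypeOfSimpleSubvariety
import HarnessLib

/-!
# The (I) ↔ (H) → Tate chain over the ONE residual binder `hSimple` (composition)

Pure composition of tree theorems; no new definition, no named fact.  Milne, *Lefschetz motives and
the Tate conjecture*, Compositio Math. 117 (1999), Theorem 7.1 (p. 72): «If the Hodge conjecture
holds for all Abelian varieties of CM-type over `C`, then the Tate conjecture (0.1) holds for all
Abelian varieties over `F`» — hypothesis (H) `∀ A, CMHodgeHypothesisAt A`; reading (I) is the Hodge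
conjecture for the realised CM codes, `CodesHC hHD hU h₃`.

After `ComplexMultiplication.hSub_simple` (a SIMPLE abelian subvariety of a complex abelian variety of
CM-type is of CM-type, with `End⁰` commutative of degree `2 dim` — Shimura 1998 §5.1 Props. 3, 4, 6),
`HodgeTheory.isogenyInvariance_hodgeConjectureFor` (van Geemen 1994 Lemma 3.7) and
`hodgePQ_independent_of_hodgeModel_holds`, the inputs of (I) ⟹ (H) that are NOT kernel theorems are
exactly:
* `hSimple : ∀ B, IsSimple B → IsOfCMType B → ∃ B′, IsCMTyped B′ ∧ IsIsogenous B B′` — a simple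
  complex abelian variety of CM-type (its `End⁰(B)` is then a commutative field of degree `2 dim B`,
  `endAlgebra_comm_and_finrank_eq_of_isSimple_of_isOfCMType`) admits an isogeny onto a principal
  CM-typed `(B′, 𝓞_K, Φ)`: Shimura 1998 §5.1 Props. 5–6 with Lemma 2 (that field is a CM field),
  §5.2 (the CM type on invariant differentials), §7.1 Prop. 7 (principalisation);
* the cited record `Shimura1998_Thm2_Cor` (§6.1 Corollary of Theorem 2: «Any two abelian varieties
  of the same CM-type are isogenous to each other»);
and, for the last step, the cited predicates `Theorem71 E` (Milne 1999 Thm. 7.1) /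
`Milne2002.Theorem33 ℓ W` (Milne 2002 Thm. 3.3).

## References
* [Milne1999] J. S. Milne, Lefschetz motives and the Tate conjecture, Compositio Math. 117 (1999) 45–76, §2 p. 54, §7 Thm. 7.1 p. 72.
* [Milne2002Polarizations] J. S. Milne, Polarizations and Grothendieck's standard conjectures, Ann. of Math. 155 (2002), Thm. 3.3 p. 607.
* [Shimura1998] G. Shimura, Abelian Varieties with Complex Multiplication and Modular Functions, Princeton 1998, §5.1 Props. 1–6, §5.2, §6.1 Cor. of Thm. 2, §7.1 Prop. 7.
* [vanGeemen1994HodgeAV] B. van Geemen, An introduction to the Hodge conjecture for abelian varieties, LNM 1594 (1994), Lemma 3.7 p. 236.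
-/

noncomputable section

open CategoryTheory

namespace Literature.AlgebraicGeometry.Milne1999

open Literature.AlgebraicGeometry.Motives
open Literature.AlgebraicGeometry.HodgeTheory
open Literature.AlgebraicGeometry.ComplexMultiplication
open Literature.NumberTheory.Automorphic

/-- The split binder `hSimpleSub` of `forall_cmHodgeHypothesisAt_of_codesHC_split` from `hSimple`
alone: CM-type descends to SIMPLE abelian subvarieties by the tree theorem
`ComplexMultiplication.hSub_simple` (Shimura 1998 §5.1 Props. 3, 4, 6).
[cite: Shimura1998, §5.1 Props. 3, 4, 6 (pp. 35–37)] [cite: Milne1999, §2 p. 54] -/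
theorem hSimpleSub_of_hSimple
    (hSimple : ∀ B : AbelianVariety ℂ, AbelianVariety.IsSimple B → IsOfCMType B →
      ∃ B' : AbelianVariety ℂ, IsCMTyped B' ∧ AbelianVariety.IsIsogenous B B') :
    ∀ (A B : AbelianVariety ℂ) (f : B ⟶ A),
      AlgebraicGeometry.IsClosedImmersion (AbelianVariety.Hom.toSchemeHom f) → AbelianVariety.IsSimple B →
      IsOfCMType A → ∃ B' : AbelianVariety ℂ, IsCMTyped B' ∧ AbelianVariety.IsIsogenous B B' :=
  fun A B f hf hs hA ↦ hSimple B hs (hSub_simple A B f hf hs hA)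

/-- **(I) ⟹ (H) over the one residual binder `hSimple`** (with `hI`, `hIso`, `hSub` all kernel):
from the Hodge conjecture on the realised CM codes (`CodesHC`), Shimura's §6.1 Corollary
(`Shimura1998_Thm2_Cor`) and `hSimple`, Milne's hypothesis (H) `∀ A, CMHodgeHypothesisAt A`.
[cite: Milne1999, §2 p. 54 and §7 p. 72] [cite: Shimura1998, §6.1 Corollary of Theorem 2 (p. 41)]
[cite: vanGeemen1994HodgeAV, Lemma 3.7 (p. 236)] -/
theorem forall_cmHodgeHypothesisAt_of_codesHC'
    {hHD : exists_isReal_hodgeModel}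
    {hU : PicardCM.BallQuotientUniformisedDatum} {h₃ : PicardCM.CMAbelianVarietyRealised}
    (hC : CodesHC hHD hU h₃) (hcor : Shimura1998_Thm2_Cor)
    (hSimple : ∀ B : AbelianVariety ℂ, AbelianVariety.IsSimple B → IsOfCMType B →
      ∃ B' : AbelianVariety ℂ, IsCMTyped B' ∧ AbelianVariety.IsIsogenous B B') :
    ∀ A : AbelianVariety ℂ, CMHodgeHypothesisAt A :=
  forall_cmHodgeHypothesisAt_of_codesHC_of_hSimpleSub hC hcor (hSimpleSub_of_hSimple hSimple)

/-- **(H) ⟺ (I) over `hSimple`**: Milne's hypothesis (H) is EQUIVALENT to the Hodge conjecture for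
the realised CM codes, given `Shimura1998_Thm2_Cor` and `hSimple` ((H) ⟹ (I) needs neither:
`codesHC_of_forall_cmHodgeHypothesisAt`). [cite: Milne1999, §2 p. 54 and §7 p. 72]
[cite: Shimura1998, §6.1 Corollary of Theorem 2 (p. 41)] -/
theorem forall_cmHodgeHypothesisAt_iff_codesHC
    {hHD : exists_isReal_hodgeModel}
    {hU : PicardCM.BallQuotientUniformisedDatum} {h₃ : PicardCM.CMAbelianVarietyRealised}
    (hcor : Shimura1998_Thm2_Cor)
    (hSimple : ∀ B : AbelianVariety ℂ, AbelianVariety.IsSimple B → IsOfCMType B →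
      ∃ B' : AbelianVariety ℂ, IsCMTyped B' ∧ AbelianVariety.IsIsogenous B B') :
    (∀ A : AbelianVariety ℂ, CMHodgeHypothesisAt A) ↔ CodesHC hHD hU h₃ :=
  forall_cmHodgeHypothesisAt_iff_codesHC_of_hSimpleSub hcor (hSimpleSub_of_hSimple hSimple)

/-- **The kernel-visible chain (I) ⟹ (H) ⟹ Tate over `hSimple`**: Milne's Theorem 7.1 at the
intended ℓ-adic data (`Theorem71 E`), the Hodge conjecture for the realised CM codes (`CodesHC`),
`Shimura1998_Thm2_Cor` and the one residual binder `hSimple` give Tate's (0.1) for every abelian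
variety over every finite field (`TateStatement01 E`). [cite: Milne1999, §7 Thm. 7.1 p. 72]
[cite: Shimura1998, §6.1 Corollary of Theorem 2 (p. 41)] -/
theorem tateAV_Fq_of_codesHC'
    {E : ∀ (k : Type) [Field k] [Finite k] (ℓ : ℕ) [Fact ℓ.Prime] [NeZero (ℓ : k)],
      GaloisWeilCohomology k ℚ_[ℓ] (padicCyclotomicCharacter k ℓ)}
    (h71 : Theorem71 E)
    {hHD : exists_isReal_hodgeModel}
    {hU : PicardCM.BallQuotientUniformisedDatum} {h₃ : PicardCM.CMAbelianVarietyRealised}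
    (hC : CodesHC hHD hU h₃) (hcor : Shimura1998_Thm2_Cor)
    (hSimple : ∀ B : AbelianVariety ℂ, AbelianVariety.IsSimple B → IsOfCMType B →
      ∃ B' : AbelianVariety ℂ, IsCMTyped B' ∧ AbelianVariety.IsIsogenous B B') :
    TateStatement01 E :=
  tateAV_Fq_of_codesHC_of_hSimpleSub h71 hC hcor (hSimpleSub_of_hSimple hSimple)

/-- **(I) ⟹ (H) ⟹ Tate over finite fields AND `D`, `Hdg` for abelian varieties over an
algebraically closed field, over `hSimple`** (Milne 1999 Thm. 7.1 and Milne 2002 Thm. 3.3 consume the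
same hypothesis (H)). [cite: Milne1999, §7 Thm. 7.1 p. 72] [cite: Milne2002Polarizations, Thm. 3.3 p. 607]
[cite: Shimura1998, §6.1 Corollary of Theorem 2 (p. 41)] -/
theorem tate_and_hodgeStandard_of_codesHC'
    {k : Type} [Field k] [IsAlgClosed k] {ℓ : ℕ} [Fact ℓ.Prime] [NeZero (ℓ : k)]
    {W : WeilCohomology k ℚ_[ℓ]}
    {E : ∀ (k' : Type) [Field k'] [Finite k'] (ℓ' : ℕ) [Fact ℓ'.Prime] [NeZero (ℓ' : k')],
      GaloisWeilCohomology k' ℚ_[ℓ'] (padicCyclotomicCharacter k' ℓ')}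
    (h71 : Theorem71 E) (h33 : Milne2002.Theorem33 ℓ W)
    {hHD : exists_isReal_hodgeModel}
    {hU : PicardCM.BallQuotientUniformisedDatum} {h₃ : PicardCM.CMAbelianVarietyRealised}
    (hC : CodesHC hHD hU h₃) (hcor : Shimura1998_Thm2_Cor)
    (hSimple : ∀ B : AbelianVariety ℂ, AbelianVariety.IsSimple B → IsOfCMType B →
      ∃ B' : AbelianVariety ℂ, IsCMTyped B' ∧ AbelianVariety.IsIsogenous B B') :
    TateStatement01 E ∧ ∀ A : AbelianVariety k, W.StandardConjectureD A.dim A.X ∧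
      ∀ η : W.obj A.X 2, W.IsHyperplaneClass A.X η → W.StandardConjectureHdg A.dim A.X η :=
  tate_and_hodgeStandard_of_codesHC_of_hSimpleSub h71 h33 hC hcor (hSimpleSub_of_hSimple hSimple)

end Literature.AlgebraicGeometry.Milne1999

end
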